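import Literature.IUT.HodgeArakelov.FlTorsorWreathToyGroup
import Literature.IUT.HodgeArakelov.CyclicToyEtaleThetaData
import Literature.IUT.HodgeArakelov.Def23StructuresIff

/-!
# A CLOSED tower on which `FlTorsorStructure` is inhabited WITH `conjAct` = CONJUGATION of cuspidal inertia
# subgroups (the WREATH `𝔽_l^{⋊±}`-TORSOR TOY — a GENUINE-ACTION witness for [IUTchII] Def 2.3 (v))

S. Mochizuki, *Inter-universal Teichmüller theory II*, kurims manuscript (Dec. 2020), §2 Def 2.3 (i) p. 67 (indices `l`,
`2l`), (iii) p. 68, (v) p. 69 («the natural action of `Π_⊇/Π_⊆` on `Π_⊆` preserves this `𝔽^±_l`-torsor structure, hence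
determines a natural outer isomorphism `Π_⊇/Π_⊆ ≅ 𝔽_l^{⋊±}»), Rmk 2.3.1 p. 69 [claim: Mochizuki2012, status: disputed]
(IUTchII §2 Def 2.3 (v), kurims p.69) (D-0012 claim key; nothing printed is asserted here).

CONSISTENCY WITNESS, TOY — consistency ≠ faithfulness; no side taken on anything printed.  The typed interface
`FlTorsorStructure C` (abc-iut-L6-t1) does not tie its field `conjAct` to conjugation (GAP-LEDGER G-w5d243-1; kernel
counter-model `FlTorsorConjActKernel.lean` on the dihedral toy p427711).  This file shows the STRENGTHENED reading is
satisfiable jointly with every tower axiom: `Π_v = Π^±_v := B := 𝔽_l → D_3` (discrete, `G_v := 1`, `k := ℂ`),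
`Π̂^cor_v := Wr = B ⋊ (D_l × ℤ/l) ⊇ Π̂^±_v := Ker(↠ D_l) ⊇ Π̂_v := Ker(↠ D_l × ℤ/l) = B` (indices `l`, `2l`;
`Π̂^cor_v/Π̂^±_v ≅ D_l ≅ 𝔽_l^{⋊±}`), `D_l` relabelling the coordinates `𝔽_l` AFFINELY (`FlTorsorWreathToyGroup.lean`); the
cusps of `Π_⊆` are ALL `Π̂^cor_v`-conjugates of `⟨s⟩ ⊆ D_3` in one coordinate — a conjugation-STABLE predicate
(`isCusp_conj`).  Label classes at both printed levels are classified by the coordinate (`chartEquiv`), conjugation by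
`g` relabels by `labAct ḡ : x ↦ ±x + a` with `(a, ±1) = quotIso ḡ` (`chartOf_conj`), whence **`genuine :
FlTorsorStructure C` with `conjAct g ⟦I⟧ := ⟦g I g⁻¹⟧`** (`conjAct_eq_conj`, `rfl`) satisfying the typed chart law — the
wanted laws `conj_stable` + `conjAct_spec` of G-w5d243-1 hold here — plus `LabCuspStructure`, `Def23_structures` (every
`D`, `Dec`) and a closed instance (`l = 3`, `p = 5`).  HONEST LIMITS: finite discrete groups, `G_v = 1`; not a model of
any tempered fundamental group.  No `def … : Prop`, no named fact, NO instance (the discrete topology of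
`Π̂^cor_v` is a field of the bundled `TopGroup` term `corhat`, Mathlib carrying none on `SemidirectProduct`).  abc-iut cell,
seat abc-iut-w5-d243 (gen 3). [claim: Mochizuki2012, status: disputed] (IUTchII §2 Def 2.3 (v), kurims p.69)
-/

noncomputable section

namespace Literature.IUT.HodgeArakelov

namespace FlTorsorWreathToy

open DihedralGroup DihedralCuspToy FlTorsorToy CyclicToy Literature.IUT.HodgeTheaters

variable (l : ℕ) in
/-- `Π̂^cor_v` of the toy as a BUNDLED topological group: `Wr` with the discrete topology supplied as the bundle's field
(Mathlib carries no topology on semidirect products; NO instance is declared — the topology lives only inside this term).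
[claim: Mochizuki2012, status: disputed] (IUTchII §2 Def 2.3 (i), kurims p.67) -/
abbrev corhat : TopGroup.{0} :=
  letI : TopologicalSpace (Wr l) := ⊥
  haveI : DiscreteTopology (Wr l) := ⟨rfl⟩
  TopGroup.of (Wr l)

variable (l p : ℕ) (hl : l.Prime) (hl2 : l ≠ 2) (hp : p.Prime) (hp2 : p ≠ 2) (hpl : p ≠ l)

/-! ## 1. The setting (`Π_v := B = 𝔽_l → D_3`), the coverings, the tower -/

/-- `Π̂^cor_v ↠ D_l × ℤ/l` (kernel `Π̂_v = B`). [claim: Mochizuki2012, status: disputed] (IUTchII §2 Def 2.3 (i), kurims p.67) -/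
abbrev projQ : Wr l →* Qg l := SemidirectProduct.rightHom

/-- `Π̂^cor_v ↠ D_l` (kernel `Π̂^±_v`). [claim: Mochizuki2012, status: disputed] (IUTchII §2 Def 2.3 (v), kurims p.69) -/
abbrev projD : Wr l →* DihedralGroup l := (MonoidHom.fst _ _).comp (projQ l)

/-- `projD` is surjective. [claim: Mochizuki2012, status: disputed] (IUTchII §2 Def 2.3 (v), kurims p.69) -/
theorem projD_surjective : Function.Surjective (projD l) := fun d => ⟨SemidirectProduct.inr (d, 1), rfl⟩

/-- `[Π̂^cor_v : Π̂^±_v] = |D_l| = 2l`. [claim: Mochizuki2012, status: disputed] (IUTchII §2 Def 2.3 (i), kurims p.67) -/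
theorem index_ker_projD : (projD l).ker.index = 2 * l := by
  rw [Subgroup.index_ker, MonoidHom.range_eq_top.mpr (projD_surjective l), Subgroup.card_top, nat_card]

/-- `[Π̂^cor_v : Π̂_v] = |D_l × ℤ/l| = 2l · l`. [claim: Mochizuki2012, status: disputed] (IUTchII §2 Def 2.3 (i), kurims p.67) -/
theorem index_ker_projQ : (projQ l).ker.index = 2 * l * l := by
  rw [Subgroup.index_ker, MonoidHom.range_eq_top.mpr SemidirectProduct.rightHom_surjective, Subgroup.card_top,
    Nat.card_prod, nat_card, Nat.card_congr (Multiplicative.toAdd : Multiplicative (ZMod l) ≃ ZMod l), Nat.card_zmod]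

/-- `Π̂_v ≤ Π̂^±_v`. [claim: Mochizuki2012, status: disputed] (IUTchII §2 Def 2.3 (i), kurims p.67) -/
theorem ker_projQ_le : (projQ l).ker ≤ (projD l).ker := by
  intro x hx
  rw [MonoidHom.mem_ker] at hx ⊢
  change (projQ l x).1 = 1
  rw [hx, Prod.fst_one]

/-- `[Π̂^±_v : Π̂_v] = l`. [claim: Mochizuki2012, status: disputed] (IUTchII §2 Def 2.3 (i), kurims p.67) -/
theorem relIndex_ker (hl0 : l ≠ 0) : (projQ l).ker.relIndex (projD l).ker = l := by
  have h := Subgroup.relIndex_mul_index (ker_projQ_le l)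
  rw [index_ker_projD, index_ker_projQ] at h
  have h' : (projQ l).ker.relIndex (projD l).ker * (2 * l) = l * (2 * l) := by rw [h]; ring
  exact Nat.eq_of_mul_eq_mul_right (by omega) h'

/-- **The toy `PlusMinusTower`** ([IUTchII] Def 2.3 (i) p. 67): `Π̂^cor_v := B ⋊ (D_l × ℤ/l)`, `Π̂^±_v := Ker(↠ D_l)`,
`Π̂_v := Ker(↠ D_l × ℤ/l) = B = Π_v = Π^±_v` (embedded by `inl`), `G_v := 1`; printed indices `l` and `2l`.
[claim: Mochizuki2012, status: disputed] (IUTchII §2 Def 2.3 (i), kurims p.67) -/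
@[reducible] def wTower : PlusMinusTower (wCoverings l p hl hl2 hp hp2 hpl) where
  Corhat := corhat l
  cor := ⊤
  pmHat := (projD l).ker
  hat := (projQ l).ker
  emb := SemidirectProduct.inl
  emb_injective := SemidirectProduct.inl_injective
  aug := 1
  aug_surjective := fun _ => ⟨1, Subsingleton.elim _ _⟩
  hat_le_pmHat := ker_projQ_le l
  emb_le_pmHat := by rintro _ ⟨b, rfl⟩; exact ker_projQ_le l (SemidirectProduct.rightHom_inl b)
  embP_le_hat := by rintro _ ⟨b, rfl⟩; exact SemidirectProduct.rightHom_inl b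
  embP_le_cor := le_top
  pmHat_normal := inferInstance
  deltaHat_normal := by rw [MonoidHom.ker_one, inf_top_eq, inf_top_eq]; infer_instance
  deltaHat_index := by
    rw [MonoidHom.ker_one, inf_top_eq, inf_top_eq]
    exact relIndex_ker l hl.ne_zero
  deltaPmHat_normal := by rw [MonoidHom.ker_one, inf_top_eq]; infer_instance
  deltaPmHat_index := by
    rw [MonoidHom.ker_one, inf_top_eq]
    change (projD l).ker.relIndex ⊤ = 2 * l
    rw [Subgroup.relIndex_top_right, index_ker_projD]
  aug_compat := ⟨ContinuousMulEquiv.refl _, fun _ => Subsingleton.elim _ _⟩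

/-- **`Π̂^cor_v/Π̂^±_v ≃* 𝔽_l^{⋊±}`**: `Π̂^±_v = Ker(Π̂^cor_v ↠ D_l)` and `D_l ≅ 𝔽_l^{⋊±}`.
[claim: Mochizuki2012, status: disputed] (IUTchII §2 Def 2.3 (v), kurims p.69) -/
def quotIso : (wTower l p hl hl2 hp hp2 hpl).Corhat ⧸ (wTower l p hl hl2 hp hp2 hpl).pmHat ≃* FlPM l :=
  (QuotientGroup.quotientKerEquivOfSurjective (projD l) (projD_surjective l)).trans (dihedralEquivFlPM l)

/-- `quotIso ḡ = dihedralEquivFlPM (D_l-component of g)`. [claim: Mochizuki2012, status: disputed] (IUTchII §2 Def 2.3 (v), kurims p.69) -/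
theorem quotIso_mk (g : Wr l) :
    quotIso l p hl hl2 hp hp2 hpl (QuotientGroup.mk g) = dihedralEquivFlPM l g.right.1 := rfl

/-! ## 2. The cusps: all conjugates of the standard cusps (a conjugation-stable predicate) -/

/-- **The toy `CuspidalInertiaData`**: the cuspidal inertia subgroups of `Π_⊆` are the `Π̂^cor_v`-conjugates of the
standard cusps `stdCusp e` (`⟨s⟩ ⊆ D_3` in coordinate `e`) contained in `Π_⊆`.
[claim: Mochizuki2012, status: disputed] (IUTchII §2 Def 2.3 (ii), kurims p.68) -/
@[reducible] def wCusps : CuspidalInertiaData (wTower l p hl hl2 hp hp2 hpl) where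
  IsCuspidalInertia Q I := I ≤ Q ∧ ∃ (e : ZMod l) (g : Wr l), I = (stdCusp l e).map (MulAut.conj g).toMonoidHom
  le_of_isCuspidalInertia h := h.1

/-- **Conjugation-stability** (the wanted law `conj_stable` of G-w5d243-1; print: Rmk 2.3.1): the cusps of the NORMAL
subgroup `Π̂^±_v` are permuted by `Π̂^cor_v`-conjugation. [claim: Mochizuki2012, status: disputed] (IUTchII §2 Rmk 2.3.1, kurims p.69) -/
theorem isCusp_conj (g : Wr l) {I : Subgroup (Wr l)}
    (hI : (wCusps l p hl hl2 hp hp2 hpl).IsCuspidalInertia (wTower l p hl hl2 hp hp2 hpl).pmHat I) :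
    (wCusps l p hl hl2 hp hp2 hpl).IsCuspidalInertia (wTower l p hl hl2 hp hp2 hpl).pmHat
      (I.map (MulAut.conj g).toMonoidHom) := by
  obtain ⟨hle, e, g', rfl⟩ := hI
  refine ⟨?_, e, g * g', ?_⟩
  · rintro _ ⟨x, hx, rfl⟩
    exact (projD l).normal_ker.conj_mem x (hle hx) g
  · rw [Subgroup.map_map, map_mul]
    rfl

/-! ## 3. Label classes at a level `Π_⊆ ⊆ Π_⊇`, `Π_⊇ = {x | x.right ∈ R'}` with `R' ≤ 1 × ℤ/l` -/

section Level

variable {R' : Subgroup (Qg l)} {Qsub Qsup : Subgroup (Wr l)}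

/-- NORMAL FORM of a cusp: every cusp is `(stdCusp c)^{inl h}` for some coordinate `c` and `h ∈ B`.
[claim: Mochizuki2012, status: disputed] (IUTchII §2 Def 2.3 (ii), kurims p.68) -/
theorem exists_normalForm {I : Subgroup (Wr l)} (hI : (wCusps l p hl hl2 hp hp2 hpl).IsCuspidalInertia Qsub I) :
    ∃ (c : ZMod l) (h : B l), I = (stdCusp l c).map (MulAut.conj (SemidirectProduct.inl h : Wr l)).toMonoidHom := by
  obtain ⟨-, e, g, rfl⟩ := hI
  obtain ⟨h, hh⟩ := exists_stdCusp_conj_inl l e g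
  exact ⟨_, h, hh⟩

/-- The COORDINATE of a cusp (the `c` of some normal form). [claim: Mochizuki2012, status: disputed] (IUTchII §2 Def 2.3 (v), kurims p.69) -/
def coordOf {I : Subgroup (Wr l)} (hI : (wCusps l p hl hl2 hp hp2 hpl).IsCuspidalInertia Qsub I) : ZMod l :=
  Classical.choose (exists_normalForm l p hl hl2 hp hp2 hpl hI)

/-- The coordinate comes with a normal form. [claim: Mochizuki2012, status: disputed] (IUTchII §2 Def 2.3 (v), kurims p.69) -/
theorem coordOf_spec {I : Subgroup (Wr l)} (hI : (wCusps l p hl hl2 hp hp2 hpl).IsCuspidalInertia Qsub I) :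
    ∃ h : B l, I = (stdCusp l (coordOf l p hl hl2 hp hp2 hpl hI)).map
      (MulAut.conj (SemidirectProduct.inl h : Wr l)).toMonoidHom :=
  Classical.choose_spec (exists_normalForm l p hl hl2 hp hp2 hpl hI)

variable (hR' : ∀ q ∈ R', q.1 = 1) (hQ : ∀ x, x ∈ Qsup ↔ x.right ∈ R')
include hR' hQ

/-- **Classification of label classes by coordinate**: `(stdCusp c)^{inl h}` and `(stdCusp c')^{inl h'}` lie in the same
`±`-label class (normalisers `Π_⊇`-conjugate) iff `c = c'`. [claim: Mochizuki2012, status: disputed] (IUTchII §2 Def 2.3 (iii), kurims p.68) -/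
theorem labelRel_iff (c c' : ZMod l) (h h' : B l) :
    (∃ n ∈ Qsup,
      (Subgroup.normalizer ((((stdCusp l c').map (MulAut.conj (SemidirectProduct.inl h' : Wr l)).toMonoidHom).subgroupOf
          Qsup : Subgroup Qsup) : Set Qsup)).map Qsup.subtype =
        ((Subgroup.normalizer ((((stdCusp l c).map (MulAut.conj (SemidirectProduct.inl h : Wr l)).toMonoidHom).subgroupOf
          Qsup : Subgroup Qsup) : Set Qsup)).map Qsup.subtype).map (MulAut.conj n).toMonoidHom) ↔ c = c' := by
  have hinl : ∀ b : B l, (SemidirectProduct.inl b : Wr l) ∈ Qsup := fun b =>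
    (hQ _).mpr (by rw [SemidirectProduct.right_inl]; exact one_mem R')
  have hstd : ∀ d : ZMod l, stdCusp l d ≤ Qsup := fun d x hx =>
    (hQ x).mpr (by rw [((mem_stdCusp_iff l d x).mp hx).1]; exact one_mem R')
  have eN : ∀ (d : ZMod l) (b : B l),
      (Subgroup.normalizer ((((stdCusp l d).map (MulAut.conj (SemidirectProduct.inl b : Wr l)).toMonoidHom).subgroupOf
          Qsup : Subgroup Qsup) : Set Qsup)).map Qsup.subtype =
        (Subgroup.normalizer (stdCusp l d : Set (Wr l)) ⊓ Qsup).map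
          (MulAut.conj (SemidirectProduct.inl b : Wr l)).toMonoidHom := by
    intro d b
    rw [normalizerMap_conj l (hstd d) (hinl b), ← Subgroup.subgroupOf_normalizer_eq (hstd d),
      Subgroup.subgroupOf_map_subtype]
  constructor
  · rintro ⟨n, hn, hN⟩
    rw [eN, eN, map_conj_map_conj] at hN
    refine eq_of_normalizer_conj l hR' hQ (n := (SemidirectProduct.inl h')⁻¹ * (n * SemidirectProduct.inl h))
      (Qsup.mul_mem (Qsup.inv_mem (hinl h')) (Qsup.mul_mem hn (hinl h))) ?_
    rw [← map_conj_map_conj, ← hN, map_conj_map_conj, inv_mul_cancel, map_conj_one]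
  · rintro rfl
    refine ⟨SemidirectProduct.inl (h' * h⁻¹), hinl _, ?_⟩
    rw [eN, eN, map_conj_map_conj, ← map_mul, inv_mul_cancel_right]

/-- Two normal forms of the same label class have the same coordinate; in particular `coordOf` is constant on
label classes. [claim: Mochizuki2012, status: disputed] (IUTchII §2 Def 2.3 (v), kurims p.69) -/
theorem coordOf_eq_of_labelRel {I J : Subgroup (Wr l)}
    (hI : (wCusps l p hl hl2 hp hp2 hpl).IsCuspidalInertia Qsub I) (hJ : (wCusps l p hl hl2 hp hp2 hpl).IsCuspidalInertia Qsub J)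
    {c : ZMod l} {h : B l} (e : J = (stdCusp l c).map (MulAut.conj (SemidirectProduct.inl h : Wr l)).toMonoidHom)
    (hrel : labelRel (wCusps l p hl hl2 hp hp2 hpl) Qsub Qsup ⟨I, hI⟩ ⟨J, hJ⟩) :
    coordOf l p hl hl2 hp hp2 hpl hI = c := by
  obtain ⟨h₁, hh₁⟩ := coordOf_spec l p hl hl2 hp hp2 hpl hI
  obtain ⟨n, hn, hN⟩ := hrel
  refine (labelRel_iff l hR' hQ _ c h₁ h).mp ⟨n, hn, ?_⟩
  simp only [← hh₁, ← e]
  exact hN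

/-- The chart `LabCusp^±(Π_⊆) → 𝔽_l`: the coordinate of a label class. [claim: Mochizuki2012, status: disputed] (IUTchII §2 Def 2.3 (v), kurims p.69) -/
def chartOf : LabCuspPM (wCusps l p hl hl2 hp hp2 hpl) Qsub Qsup → ZMod l :=
  Quot.lift (fun I => coordOf l p hl hl2 hp hp2 hpl I.2) (by
    rintro ⟨I, hI⟩ ⟨J, hJ⟩ hrel
    obtain ⟨h₂, hh₂⟩ := coordOf_spec l p hl hl2 hp hp2 hpl hJ
    exact coordOf_eq_of_labelRel l p hl hl2 hp hp2 hpl hR' hQ hI hJ hh₂ hrel)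

/-- The chart on a class in normal form: `chartOf ⟦(stdCusp c)^{inl h}⟧ = c`.
[claim: Mochizuki2012, status: disputed] (IUTchII §2 Def 2.3 (v), kurims p.69) -/
theorem chartOf_mk {c : ZMod l} {h : B l} {I : Subgroup (Wr l)}
    (hI : (wCusps l p hl hl2 hp hp2 hpl).IsCuspidalInertia Qsub I)
    (e : I = (stdCusp l c).map (MulAut.conj (SemidirectProduct.inl h : Wr l)).toMonoidHom) :
    chartOf l p hl hl2 hp hp2 hpl hR' hQ (Quot.mk _ ⟨I, hI⟩) = c :=
  coordOf_eq_of_labelRel l p hl hl2 hp hp2 hpl hR' hQ hI hI e ⟨1, one_mem _, by rw [map_conj_one]⟩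

/-- **`LabCusp^±(Π_⊆) ≃ 𝔽_l`** at the level `(Π_⊆, Π_⊇)`. [claim: Mochizuki2012, status: disputed] (IUTchII §2 Def 2.3 (v), kurims p.69) -/
def chartEquiv (hsub : Qsub ≤ Qsup) (hstd : ∀ c, stdCusp l c ≤ Qsub) :
    LabCuspPM (wCusps l p hl hl2 hp hp2 hpl) Qsub Qsup ≃ ZMod l where
  toFun := chartOf l p hl hl2 hp hp2 hpl hR' hQ
  invFun c := Quot.mk _ ⟨stdCusp l c, hstd c, c, 1, by rw [map_conj_one]⟩
  left_inv t := by
    induction t using Quot.ind with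
    | mk I =>
      obtain ⟨I, hI⟩ := I
      obtain ⟨h, hh⟩ := coordOf_spec l p hl hl2 hp hp2 hpl hI
      have hn : (SemidirectProduct.inl h : Wr l) ∈ Qsup :=
        (hQ _).mpr (by rw [SemidirectProduct.right_inl]; exact one_mem R')
      refine Quot.sound ⟨SemidirectProduct.inl h, hn, ?_⟩
      show (Subgroup.normalizer ((I.subgroupOf Qsup : Subgroup Qsup) : Set Qsup)).map Qsup.subtype =
        ((Subgroup.normalizer (((stdCusp l (coordOf l p hl hl2 hp hp2 hpl hI)).subgroupOf Qsup : Subgroup Qsup) :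
          Set Qsup)).map Qsup.subtype).map (MulAut.conj (SemidirectProduct.inl h : Wr l)).toMonoidHom
      conv_lhs => rw [hh]
      exact normalizerMap_conj l ((hstd _).trans hsub) hn
  right_inv c := chartOf_mk l p hl hl2 hp hp2 hpl hR' hQ _ (h := 1) (by rw [map_one, map_conj_one])

/-- **Equivariance**: conjugation by `g` relabels by `labAct ḡ` — `chart ⟦g I g⁻¹⟧ = labAct ḡ (chart ⟦I⟧)`.
[claim: Mochizuki2012, status: disputed] (IUTchII §2 Def 2.3 (v), kurims p.69) -/
theorem chartOf_conj {I : Subgroup (Wr l)} (hI : (wCusps l p hl hl2 hp hp2 hpl).IsCuspidalInertia Qsub I)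
    (g : Wr l) (hgI : (wCusps l p hl hl2 hp hp2 hpl).IsCuspidalInertia Qsub (I.map (MulAut.conj g).toMonoidHom)) :
    chartOf l p hl hl2 hp hp2 hpl hR' hQ (Quot.mk _ ⟨_, hgI⟩) =
      labAct l g.right.1 (chartOf l p hl hl2 hp hp2 hpl hR' hQ (Quot.mk _ ⟨I, hI⟩)) := by
  obtain ⟨h, hh⟩ := coordOf_spec l p hl hl2 hp hp2 hpl hI
  obtain ⟨h', hh'⟩ := exists_stdCusp_conj_inl l (coordOf l p hl hl2 hp hp2 hpl hI) (g * SemidirectProduct.inl h)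
  rw [← map_conj_map_conj, ← hh] at hh'
  have e := chartOf_mk l p hl hl2 hp hp2 hpl hR' hQ hgI hh'
  rw [SemidirectProduct.mul_right, SemidirectProduct.right_inl, mul_one] at e
  rw [e]
  rfl

end Level

/-! ## 4. The two printed levels and the GENUINE `FlTorsorStructure` -/

/-- Level `Π̂^±_v ⊆ Π̂^±_v`: membership. [claim: Mochizuki2012, status: disputed] (IUTchII §2 Def 2.3 (i), kurims p.67) -/
theorem mem_pmHat_iff (x : Wr l) :
    x ∈ (wTower l p hl hl2 hp hp2 hpl).pmHat ↔ x.right ∈ (MonoidHom.fst (DihedralGroup l) (Multiplicative (ZMod l))).ker :=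
  Iff.rfl

/-- Level `Π_v ⊆ Π^±_v`: membership (`Π_v = Π^±_v = B ⋊ 1`). [claim: Mochizuki2012, status: disputed] (IUTchII §2 Def 2.3 (i), kurims p.67) -/
theorem mem_piPM_iff (x : Wr l) : x ∈ (wTower l p hl hl2 hp hp2 hpl).piPM ↔ x.right ∈ (⊥ : Subgroup (Qg l)) := by
  change x ∈ (SemidirectProduct.inl : B l →* Wr l).range ↔ _
  rw [SemidirectProduct.range_inl_eq_ker_rightHom, MonoidHom.mem_ker, Subgroup.mem_bot]
  rfl

/-- `Π_v = Π^±_v`. [claim: Mochizuki2012, status: disputed] (IUTchII §2 Def 2.3 (i), kurims p.67) -/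
theorem piV_eq_piPM : (wTower l p hl hl2 hp hp2 hpl).piV = (wTower l p hl hl2 hp hp2 hpl).piPM := by
  change ((SemidirectProduct.inl : B l →* Wr l).comp (MonoidHom.id _)).range = (SemidirectProduct.inl : B l →* Wr l).range
  rw [MonoidHom.comp_id]

/-- Standard cusps lie in `Π_v`. [claim: Mochizuki2012, status: disputed] (IUTchII §2 Def 2.3 (ii), kurims p.68) -/
theorem stdCusp_le_piV (c : ZMod l) : stdCusp l c ≤ (wTower l p hl hl2 hp hp2 hpl).piV := by
  rw [piV_eq_piPM]; rintro _ ⟨b, _, rfl⟩; exact ⟨b, rfl⟩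

/-- **`LabCusp^±(Π̂^±_v) ≃ 𝔽_l`** — the `𝔽^±_l`-torsor chart. [claim: Mochizuki2012, status: disputed] (IUTchII §2 Def 2.3 (v), kurims p.69) -/
def chartPM : LabCuspPM (wCusps l p hl hl2 hp hp2 hpl) (wTower l p hl hl2 hp hp2 hpl).pmHat
    (wTower l p hl hl2 hp hp2 hpl).pmHat ≃ ZMod l :=
  chartEquiv l p hl hl2 hp hp2 hpl (R' := (MonoidHom.fst _ _).ker) (fun _ hq => MonoidHom.mem_ker.mp hq)
    (mem_pmHat_iff l p hl hl2 hp hp2 hpl)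
    le_rfl (fun c => (stdCusp_le_piV l p hl hl2 hp hp2 hpl c).trans
      ((wTower l p hl hl2 hp hp2 hpl).embP_le_hat.trans (wTower l p hl hl2 hp hp2 hpl).hat_le_pmHat))

/-- **`LabCusp^±(Π_v) ≃ 𝔽_l`** (Def 2.3 (iii) level). [claim: Mochizuki2012, status: disputed] (IUTchII §2 Def 2.3 (iii), kurims p.68) -/
def chartV : LabCuspPM (wCusps l p hl hl2 hp hp2 hpl) (wTower l p hl hl2 hp hp2 hpl).piV
    (wTower l p hl hl2 hp hp2 hpl).piPM ≃ ZMod l :=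
  chartEquiv l p hl hl2 hp hp2 hpl (R' := ⊥) (fun _ hq => by rw [(Subgroup.mem_bot).mp hq, Prod.fst_one])
    (mem_piPM_iff l p hl hl2 hp hp2 hpl) (piV_eq_piPM l p hl hl2 hp hp2 hpl).le (stdCusp_le_piV l p hl hl2 hp hp2 hpl)

/-- Equivariance at the `Π̂^±_v` level, for the chart `chartPM`. [claim: Mochizuki2012, status: disputed] (IUTchII §2 Def 2.3 (v), kurims p.69) -/
theorem chartPM_conj (g : Wr l) {I : Subgroup (Wr l)}
    (hI : (wCusps l p hl hl2 hp hp2 hpl).IsCuspidalInertia (wTower l p hl hl2 hp hp2 hpl).pmHat I) :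
    chartPM l p hl hl2 hp hp2 hpl (Quot.mk _ ⟨I.map (MulAut.conj g).toMonoidHom, isCusp_conj l p hl hl2 hp hp2 hpl g hI⟩) =
      labAct l g.right.1 (chartPM l p hl hl2 hp hp2 hpl (Quot.mk _ ⟨I, hI⟩)) :=
  chartOf_conj l p hl hl2 hp hp2 hpl (R' := (MonoidHom.fst _ _).ker) (fun _ hq => MonoidHom.mem_ker.mp hq)
    (mem_pmHat_iff l p hl hl2 hp hp2 hpl) hI g _

/-- **The GENUINE `FlTorsorStructure`**: chart = coordinate, `quotIso` through `D_l ≅ 𝔽_l^{⋊±}`, and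
**`conjAct g ⟦I⟧ := ⟦g I g⁻¹⟧`** — CONJUGATION of cuspidal inertia subgroups; the typed chart law holds because
conjugation relabels coordinates by `x ↦ ±x + a`. [claim: Mochizuki2012, status: disputed] (IUTchII §2 Def 2.3 (v), kurims p.69) -/
def genuine : FlTorsorStructure (wCusps l p hl hl2 hp hp2 hpl) where
  chart := chartPM l p hl hl2 hp hp2 hpl
  quotIso := quotIso l p hl hl2 hp hp2 hpl
  conjAct g t := Quot.lift (fun I => Quot.mk _ ⟨I.1.map (MulAut.conj g).toMonoidHom, isCusp_conj l p hl hl2 hp hp2 hpl g I.2⟩)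
    (by
      intro I J hrel
      apply (chartPM l p hl hl2 hp hp2 hpl).injective
      rw [chartPM_conj l p hl hl2 hp hp2 hpl g I.2, chartPM_conj l p hl hl2 hp hp2 hpl g J.2]
      exact congrArg _ (congrArg (chartPM l p hl hl2 hp hp2 hpl) (Quot.sound hrel))) t
  conjAct_chart g t := by
    induction t using Quot.ind with
    | mk I =>
      show chartPM l p hl hl2 hp hp2 hpl (Quot.mk _ ⟨_, isCusp_conj l p hl hl2 hp hp2 hpl g I.2⟩) = _
      rw [chartPM_conj l p hl hl2 hp hp2 hpl g I.2, labAct_eq, quotIso_mk]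

/-- **The wanted law `conjAct_spec` of G-w5d243-1 HOLDS**: `conjAct g ⟦I⟧ = ⟦g I g⁻¹⟧` (by `rfl`).
[claim: Mochizuki2012, status: disputed] (IUTchII §2 Def 2.3 (v), kurims p.69) -/
theorem conjAct_eq_conj (g : Wr l) (I : Subgroup (Wr l))
    (hI : (wCusps l p hl hl2 hp hp2 hpl).IsCuspidalInertia (wTower l p hl hl2 hp hp2 hpl).pmHat I) :
    (genuine l p hl hl2 hp hp2 hpl).conjAct g (Quot.mk _ ⟨I, hI⟩) =
      Quot.mk _ ⟨I.map (MulAut.conj g).toMonoidHom, isCusp_conj l p hl hl2 hp hp2 hpl g hI⟩ := rfl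

/-- `FlTorsorStructure` is inhabited by the genuine structure. [claim: Mochizuki2012, status: disputed] (IUTchII §2 Def 2.3 (v), kurims p.69) -/
theorem nonempty_flTorsorStructure : Nonempty (FlTorsorStructure (wCusps l p hl hl2 hp hp2 hpl)) :=
  ⟨genuine l p hl hl2 hp hp2 hpl⟩

/-- `LabCuspStructure` is inhabited over the same `(W, C)`. [claim: Mochizuki2012, status: disputed] (IUTchII §2 Def 2.3 (iii), kurims p.68) -/
theorem nonempty_labCuspStructure : Nonempty (LabCuspStructure (wCusps l p hl hl2 hp hp2 hpl)) :=
  LabCuspStructure.nonempty_iff_nonempty_equiv.mpr ⟨chartV l p hl hl2 hp hp2 hpl⟩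

/-- The Def 2.3 (iii)–(v) existence predicate holds over the wreath toy, for every `D`, `Dec`.
[claim: Mochizuki2012, status: disputed] (IUTchII §2 Def 2.3 (v), kurims p.69) -/
theorem def23_structures
    {D : EtaleThetaData (wBadPlaceSetting l p hl hl2 hp hp2 hpl).toThetaSetting (wBadPlaceSetting l p hl hl2 hp hp2 hpl).PiX}
    (Dec : SubgraphDecomposition (wBadPlaceSetting l p hl hl2 hp hp2 hpl) (wCoverings l p hl hl2 hp hp2 hpl) D) :
    Def23_structures Dec (wCusps l p hl hl2 hp hp2 hpl) :=
  def23_structures_of_isos Dec _ (chartV l p hl hl2 hp hp2 hpl) (quotIso l p hl hl2 hp hp2 hpl) (chartPM l p hl hl2 hp hp2 hpl)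

/-- **Closed instance** (`l := 3`, `p := 5`): there exist, in the kernel, `(S, T, D, Dec, W, C)` and an
`F : FlTorsorStructure C` whose `conjAct` IS conjugation of cuspidal inertia subgroups (the predicate being
conjugation-stable), with `Def23_structures Dec C`. [claim: Mochizuki2012, status: disputed] (IUTchII §2 Def 2.3 (v), kurims p.69) -/
theorem exists_genuine :
    ∃ (S : BadPlaceSetting.{0}) (T : TemperedCoverings S S.PiX) (D : EtaleThetaData S.toThetaSetting S.PiX)
      (Dec : SubgraphDecomposition S T D) (W : PlusMinusTower T) (C : CuspidalInertiaData W) (F : FlTorsorStructure C)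
      (stable : ∀ (g : W.Corhat) (I : Subgroup W.Corhat), C.IsCuspidalInertia W.pmHat I →
        C.IsCuspidalInertia W.pmHat (I.map (MulAut.conj g).toMonoidHom)),
      Def23_structures Dec C ∧
        ∀ (g : W.Corhat) (I : Subgroup W.Corhat) (hI : C.IsCuspidalInertia W.pmHat I),
          F.conjAct g (Quot.mk _ ⟨I, hI⟩) = Quot.mk _ ⟨I.map (MulAut.conj g).toMonoidHom, stable g I hI⟩ :=
  ⟨wBadPlaceSetting 3 5 Nat.prime_three (by decide) Nat.prime_five (by decide) (by decide), _,
    degenerateEtaleThetaData _, degenerateDecomposition _ _ _, _, _,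
    genuine 3 5 Nat.prime_three (by decide) Nat.prime_five (by decide) (by decide),
    fun g _ hI => isCusp_conj 3 5 Nat.prime_three (by decide) Nat.prime_five (by decide) (by decide) g hI,
    def23_structures 3 5 Nat.prime_three (by decide) Nat.prime_five (by decide) (by decide) _,
    fun g I hI => conjAct_eq_conj 3 5 Nat.prime_three (by decide) Nat.prime_five (by decide) (by decide) g I hI⟩

end FlTorsorWreathToy

end Literature.IUT.HodgeArakelov

end
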